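import Mathlib
import Summits.ValiantsHypothesis.ValiantsHypothesis.Theses.OneNatPerBit

/-!
# Route `OneNatPerBit` — `LawImpliesGap` (item stmt-ValiantsHypothesis-10321)

`LawImpliesGap := ExpCorrelationLaw → CorrelationGap`.

Pure bookkeeping ("exponential beats polynomial").  `ExpCorrelationLaw` provides `C : ℕ` and
`0 < θ < 1` with, for every `n ≥ 1` and every fan-in-two circuit `P` in the `x_ij`,
`|Σ_σ coeff_(x_σ) P.eval|² ≤ C · (size P + n)^C · θ^n · n! · Σ_m |coeff_m P.eval|²`.
For circuits of size `≤ n^c` we have `size P + n ≤ 2 n^(c+1)` (for `n ≥ 1`), hence the factor is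
at most `C · 2^C · n^((c+1)C) · θ^n`, and `n^k θ^n → 0` (Mathlib:
`tendsto_pow_const_mul_const_pow_of_lt_one`), so `2 · C · 2^C · n^((c+1)C) · θ^n < 1` for all
large `n`; multiplying by the nonnegative `n! · Σ_m |coeff_m P.eval|²` gives `CorrelationGap`
(`corr² ≤ 1/2`) from `n₀ := max N 1` on.
-/

-- `Summit.ValiantsHypothesis.ValiantsHypothesis.…` is the tree's mandated single-conjunct layout
-- (Sub = Summit), so the duplicated namespace component is intended.
set_option linter.dupNamespace false

namespace Summit.ValiantsHypothesis.ValiantsHypothesis.Theorems.OneNatPerBit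

open Literature.Computability.AlgebraicComplexity
open Summit.ValiantsHypothesis.ValiantsHypothesis.Theses.OneNatPerBit

/-- Elementary real-number core of the decay step: if `0 < θ < 1` then for every `C c : ℕ` there
is `N` such that `2 · C · x^C · θ^n ≤ 1` for all `n ≥ N` with `1 ≤ n` and every real
`0 ≤ x ≤ n^c + n` (we use `x := size P + n`).  [folklore] -/
theorem eventually_two_mul_polyFactor_le_one (C c : ℕ) {θ : ℝ} (hθ0 : 0 < θ) (hθ1 : θ < 1) :
    ∃ N : ℕ, ∀ n : ℕ, N ≤ n → 1 ≤ n → ∀ x : ℝ, 0 ≤ x → x ≤ (n : ℝ) ^ c + (n : ℝ) →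
      2 * ((C : ℝ) * x ^ C * θ ^ n) ≤ 1 := by
  -- `2 C 2^C · (n^((c+1)C) θ^n) → 0`, hence eventually `< 1`.
  have ht : Filter.Tendsto
      (fun n : ℕ => (2 * (C : ℝ) * 2 ^ C) * ((n : ℝ) ^ ((c + 1) * C) * θ ^ n))
      Filter.atTop (nhds 0) := by
    have h := (tendsto_pow_const_mul_const_pow_of_lt_one ((c + 1) * C) hθ0.le hθ1).const_mul
      (2 * (C : ℝ) * 2 ^ C)
    simpa only [mul_zero] using h
  have hev : ∀ᶠ n : ℕ in Filter.atTop,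
      (2 * (C : ℝ) * 2 ^ C) * ((n : ℝ) ^ ((c + 1) * C) * θ ^ n) < 1 :=
    (tendsto_order.1 ht).2 1 zero_lt_one
  obtain ⟨N, hN⟩ := Filter.eventually_atTop.1 hev
  refine ⟨N, fun n hnN hn1 x hx0 hx => ?_⟩
  have hn1R : (1 : ℝ) ≤ (n : ℝ) := by exact_mod_cast hn1
  -- `x ≤ n^c + n ≤ 2 n^(c+1)` for `n ≥ 1`
  have hbase : x ≤ 2 * (n : ℝ) ^ (c + 1) := by
    have h1 : (n : ℝ) ^ c ≤ (n : ℝ) ^ (c + 1) := pow_le_pow_right₀ hn1R (Nat.le_succ c)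
    have h2 : (n : ℝ) ≤ (n : ℝ) ^ (c + 1) := by
      calc (n : ℝ) = (n : ℝ) ^ 1 := (pow_one _).symm
        _ ≤ (n : ℝ) ^ (c + 1) := pow_le_pow_right₀ hn1R (Nat.succ_le_succ (Nat.zero_le c))
    linarith
  have hpowC : x ^ C ≤ 2 ^ C * (n : ℝ) ^ ((c + 1) * C) := by
    calc x ^ C ≤ (2 * (n : ℝ) ^ (c + 1)) ^ C := pow_le_pow_left₀ hx0 hbase C
      _ = 2 ^ C * (n : ℝ) ^ ((c + 1) * C) := by rw [mul_pow, ← pow_mul]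
  have hC0 : (0 : ℝ) ≤ (C : ℝ) := Nat.cast_nonneg C
  have hθn : (0 : ℝ) ≤ θ ^ n := pow_nonneg hθ0.le n
  have h1 : (C : ℝ) * x ^ C ≤ (C : ℝ) * (2 ^ C * (n : ℝ) ^ ((c + 1) * C)) :=
    mul_le_mul_of_nonneg_left hpowC hC0
  have h2 : (C : ℝ) * x ^ C * θ ^ n ≤ (C : ℝ) * (2 ^ C * (n : ℝ) ^ ((c + 1) * C)) * θ ^ n :=
    mul_le_mul_of_nonneg_right h1 hθn
  have h3 := hN n hnN
  calc 2 * ((C : ℝ) * x ^ C * θ ^ n)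
      ≤ 2 * ((C : ℝ) * (2 ^ C * (n : ℝ) ^ ((c + 1) * C)) * θ ^ n) := by linarith
    _ = (2 * (C : ℝ) * 2 ^ C) * ((n : ℝ) ^ ((c + 1) * C) * θ ^ n) := by ring
    _ ≤ 1 := h3.le

/-- **Settles item stmt-ValiantsHypothesis-10321** (support of route `OneNatPerBit`):
`ExpCorrelationLaw → CorrelationGap`.  Given the law's `C, θ` and an exponent `c`, take
`n₀ := max N 1` with `N` from `eventually_two_mul_polyFactor_le_one`; for `n ≥ n₀` and a
fan-in-two circuit of size `≤ n^c` the law's factor `C (size P + n)^C θ^n` is `≤ 1/2`, so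
`2 |Σ_σ coeff_(x_σ) P.eval|² ≤ n! Σ_m |coeff_m P.eval|²`. [folklore] -/
theorem lawImpliesGap_proof :
    Summit.ValiantsHypothesis.ValiantsHypothesis.Theses.OneNatPerBit.LawImpliesGap := by
  unfold LawImpliesGap ExpCorrelationLaw CorrelationGap
  rintro ⟨C, θ, hθ0, hθ1, hlaw⟩ c
  obtain ⟨N, hN⟩ := eventually_two_mul_polyFactor_le_one C c hθ0 hθ1
  refine ⟨max N 1, fun n hn P hfan hsize => ?_⟩
  have hnN : N ≤ n := le_trans (le_max_left _ _) hn
  have hn1 : 1 ≤ n := le_trans (le_max_right _ _) hn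
  have hmain := hlaw n hn1 P hfan
  have hx0 : (0 : ℝ) ≤ (P.size : ℝ) + (n : ℝ) := by positivity
  have hx : (P.size : ℝ) + (n : ℝ) ≤ (n : ℝ) ^ c + (n : ℝ) := by
    have hsizeR : (P.size : ℝ) ≤ (n : ℝ) ^ c := by exact_mod_cast hsize
    linarith
  have hK := hN n hnN hn1 ((P.size : ℝ) + (n : ℝ)) hx0 hx
  have hS0 : 0 ≤ P.eval.support.sum (fun m => ‖MvPolynomial.coeff m P.eval‖ ^ 2) :=
    Finset.sum_nonneg (fun m _ => by positivity)
  have hF0 : (0 : ℝ) ≤ (n.factorial : ℝ) := by positivity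
  have hFS : 0 ≤ (n.factorial : ℝ) *
      P.eval.support.sum (fun m => ‖MvPolynomial.coeff m P.eval‖ ^ 2) := mul_nonneg hF0 hS0
  have hprod := mul_le_mul_of_nonneg_right hK hFS
  calc 2 * ‖∑ σ : Equiv.Perm (Fin n), MvPolynomial.coeff (permMonomial σ) P.eval‖ ^ 2
      ≤ 2 * ((C : ℝ) * ((P.size : ℝ) + (n : ℝ)) ^ C * θ ^ n * (n.factorial : ℝ) *
          P.eval.support.sum (fun m => ‖MvPolynomial.coeff m P.eval‖ ^ 2)) := by linarith
    _ = 2 * ((C : ℝ) * ((P.size : ℝ) + (n : ℝ)) ^ C * θ ^ n) * ((n.factorial : ℝ) *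
          P.eval.support.sum (fun m => ‖MvPolynomial.coeff m P.eval‖ ^ 2)) := by ring
    _ ≤ 1 * ((n.factorial : ℝ) *
          P.eval.support.sum (fun m => ‖MvPolynomial.coeff m P.eval‖ ^ 2)) := hprod
    _ = (n.factorial : ℝ) *
          P.eval.support.sum (fun m => ‖MvPolynomial.coeff m P.eval‖ ^ 2) := one_mul _

end Summit.ValiantsHypothesis.ValiantsHypothesis.Theorems.OneNatPerBit
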